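import Literature.NumberTheory.DiophantineApproximation.RhinViolaTheorem21
import Literature.NumberTheory.DiophantineApproximation.ViolaZudilinResidueIntegrals
import HarnessLib

/-!
# Viola–Zudilin 2018, Lemma 2.1: the arithmetic of `J_z`, `J_z^{(1)}`, `J_z^{(2)}`

Topic `Literature/NumberTheory/DiophantineApproximation`. DEFINITIONS (the Viola–Zudilin exponents
`H, H', α, β, δ` of (2.1) for a six-parameter tuple, and three auxiliary exponents of the proof) and the
PROVED Lemma 2.1; no named facts.

**Lemma 2.1** [Viola–Zudilin, J. reine angew. Math. 736 (2018), Lemma 2.1 = MPIM 2014-26 pp. 5–7]. Let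
`H = max{l+q, h+m−k, h+j−l, j+k−m}`, `H' = max{l+q, min{h+m−k, h+j−l}, j+k−m}`,
`α = max{0, l+q−k, l+q−m}`, `β = max{0, k+l−h}`, `δ = α+β+h+j−l`. Then
`d_H d_{H'} z^α (1−z)^β J_z = P(z) − Q(z) Li₂(1/z)`, `d_H d_{H'} z^α (1−z)^β J_z^{(1)} = R(z) − Q(z) Li₁(1/z)`,
`d_H d_{H'} z^α (1−z)^β J_z^{(2)} = Q(z)` with `P, Q, R ∈ ℤ[z]` of degrees `≤ δ` (`lemma21`, for real `z > 1`,
under the standing hypotheses `j+k ≥ m`, `j+q ≥ m` of §2.1).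

Proof (following the printed one, made rigorous where the paper is brief). With `N = j+q−m`, the second
representation `J^{(μ)} = Σ_λ binom(N,λ) z^{k+m−q+λ}(z−1)^λ I^{(μ)}(h,j,k+λ,l,m+λ)` and Rhin–Viola's Theorem 2.1
(`RhinViola.theorem21`) for each child tuple give the three identities with the normaliser
`d_H d_{H'} z^{A}(1−z)^β`, `A = max{N, α}` and degrees `≤ A+β+h+j−l` (`latter_identities`; bookkeeping:
`H_λ ≤ H`, `K_λ ≤ H'`, `α_λ ≤ A+k+m−q+λ`, `β_λ ≤ β+λ`, and RV Lemma 2.8 `δ_λ = α_λ+β_λ+h−k−λ−l`, VZ (2.4));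
the first representation `J^{(μ)} = Σ_λ binom(N,λ) z^{j+k+λ} I^{(μ)}(h,j,k+λ,j+l+q−m−λ,m+λ)` gives them with
the normaliser `d_H d_{H'} z^{α}(1−z)^{B}`, `B = max{0,k+l+N−h}` (`former_identities`). Comparing the two
expressions for `d_H d_{H'} z^{A}(1−z)^{B} J^{(μ)}` yields `z^{A−α} Q_former = (1−z)^{B−β} Q_latter` on
`(1,∞)`, hence in `ℤ[X]`, so `X^{A−α} ∣ Q_latter` (and likewise `R`, `P`) by coprimality of `X` and `1−X`
(`exists_eq_X_pow_mul`); dividing out `z^{A−α}` gives the printed normaliser and the degree bound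
`(A+β+h+j−l) − (A−α) = δ`. (The paper says "the former representation leads to the expression for `α`, the
latter yields the formula for `β`"; the comparison step is the present file's way of combining them.)

## References

* C. Viola, W. Zudilin, *Linear independence of dilogarithmic values*, J. reine angew. Math. 736 (2018)
  193–223, (2.1)–(2.4), Lemma 2.1. [ViolaZudilin2018]
* G. Rhin, C. Viola, Ann. Sc. Norm. Super. Pisa Cl. Sci. (5) 4 (2005) 389–437, Theorem 2.1, Lemma 2.8.
  [RhinViola2005]
-/

noncomputable section

namespace Literature.NumberTheory.DiophantineApproximation

namespace ViolaZudilin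

open Finset Polynomial
open DilogPade (polylogSeries)
open RhinViola (I I1 I2 theorem21 natDegree_C_mul_X_pow_mul_le aeval_C_mul_X_pow_mul)
open Literature.NumberTheory.LFunctions (lcmUpto_dvd_lcmUpto_of_le)

/-! ### The Viola–Zudilin exponents (2.1) -/

/-- `H = max{l+q, h+m−k, h+j−l, j+k−m}` (VZ (2.1)). [cite: ViolaZudilin2018, (2.1)] -/
def bigH (h j k l m q : ℕ) : ℕ := max (max (l + q) (h + m - k)) (max (h + j - l) (j + k - m))

/-- `H' = max{l+q, min{h+m−k, h+j−l}, j+k−m}` (VZ (2.1)). [cite: ViolaZudilin2018, (2.1)] -/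
def bigH' (h j k l m q : ℕ) : ℕ := max (max (l + q) (min (h + m - k) (h + j - l))) (j + k - m)

/-- `α = max{0, l+q−k, l+q−m}` (VZ (2.1); truncated subtraction realises the `0`). [cite: ViolaZudilin2018, (2.1)] -/
def alpha (_h _j k l m q : ℕ) : ℕ := max (l + q - k) (l + q - m)

/-- `β = max{0, k+l−h}` (VZ (2.1)). [cite: ViolaZudilin2018, (2.1)] -/
def beta (h _j k l _m _q : ℕ) : ℕ := k + l - h

/-- `δ = α + β + h + j − l` (VZ (2.1); `β + h ≥ l`, so no truncation occurs). [cite: ViolaZudilin2018, (2.1)] -/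
def delta (h j k l m q : ℕ) : ℕ := alpha h j k l m q + beta h j k l m q + h + j - l

/-- Auxiliary exponent of the proof: `A = max{j+q−m, α}`, the power of `z` the second representation needs.
[cite: ViolaZudilin2018, Lemma 2.1 (proof)] -/
def alphaLat (h j k l m q : ℕ) : ℕ := max (j + q - m) (alpha h j k l m q)

/-- Auxiliary exponent of the proof: `B = max{0, k+l+(j+q−m)−h}`, the power of `1−z` the first representation
needs. [cite: ViolaZudilin2018, Lemma 2.1 (proof)] -/
def betaFor (h j k l m q : ℕ) : ℕ := k + l + (j + q - m) - h

/-- Auxiliary degree bound of the proof: `A + β + h + j − l`. [cite: ViolaZudilin2018, Lemma 2.1 (proof)] -/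
def deltaLat (h j k l m q : ℕ) : ℕ := alphaLat h j k l m q + beta h j k l m q + h + j - l

/-- VZ's `H` is Rhin–Viola's `H` of the top child `(h, j, k+N, l, m+N)`, `N = j+q−m`. [cite: ViolaZudilin2018, Lemma 2.1 (proof)] -/
theorem bigH_eq_rv {j m q : ℕ} (hq : m ≤ j + q) (h k l : ℕ) :
    bigH h j k l m q = RhinViola.bigH h j (k + (j + q - m)) l (m + (j + q - m)) := by
  have e1 : l + (m + (j + q - m)) - j = l + q := by omega
  have e2 : m + (j + q - m) + h - (k + (j + q - m)) = h + m - k := by omega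
  have e4 : j + (k + (j + q - m)) - (m + (j + q - m)) = j + k - m := by omega
  rw [RhinViola.bigH, e1, e2, e4, bigH]

/-- VZ's `H'` is Rhin–Viola's `K` of the top child. [cite: ViolaZudilin2018, Lemma 2.1 (proof)] -/
theorem bigH'_eq_rv {j m q : ℕ} (hq : m ≤ j + q) (h k l : ℕ) :
    bigH' h j k l m q = RhinViola.bigK h j (k + (j + q - m)) l (m + (j + q - m)) := by
  have e1 : l + (m + (j + q - m)) - j = l + q := by omega
  have e2 : m + (j + q - m) + h - (k + (j + q - m)) = h + m - k := by omega
  have e4 : j + (k + (j + q - m)) - (m + (j + q - m)) = j + k - m := by omega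
  rw [RhinViola.bigK, e1, e2, e4, bigH']

/-! ### Generic algebra of the proof -/

/-- Summing child identities `n_λ F_λ = V_λ(z) − U_λ(z)·L` against coefficients with `Nm·c_λ = E_λ(z)·n_λ`.
[cite: ViolaZudilin2018, Lemma 2.1 (proof)] -/
theorem sum_combination (s : Finset ℕ) {z Nm L : ℝ} {c nT F : ℕ → ℝ} {E V U : ℕ → ℤ[X]}
    (hE : ∀ i ∈ s, Nm * c i = aeval z (E i) * nT i)
    (hV : ∀ i ∈ s, nT i * F i = aeval z (V i) - aeval z (U i) * L) :
    Nm * ∑ i ∈ s, c i * F i = aeval z (∑ i ∈ s, E i * V i) - aeval z (∑ i ∈ s, E i * U i) * L := by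
  rw [mul_sum, map_sum, map_sum, sum_mul, ← sum_sub_distrib]
  refine sum_congr rfl fun i hi => ?_
  rw [← mul_assoc, hE i hi, map_mul, map_mul, mul_assoc, hV i hi]
  ring

/-- The same without a transcendental part. [cite: ViolaZudilin2018, Lemma 2.1 (proof)] -/
theorem sum_combination₀ (s : Finset ℕ) {z Nm : ℝ} {c nT F : ℕ → ℝ} {E V : ℕ → ℤ[X]}
    (hE : ∀ i ∈ s, Nm * c i = aeval z (E i) * nT i) (hV : ∀ i ∈ s, nT i * F i = aeval z (V i)) :
    Nm * ∑ i ∈ s, c i * F i = aeval z (∑ i ∈ s, E i * V i) := by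
  rw [mul_sum, map_sum]
  refine sum_congr rfl fun i hi => ?_
  rw [← mul_assoc, hE i hi, map_mul, mul_assoc, hV i hi]

/-- **The comparison step**: if `z^a V_f(z) = (1−z)^b V_l(z)` for all `z > 1` (`V_f, V_l ∈ ℤ[X]`), then
`X^a ∣ V_l` in `ℤ[X]` (identity of polynomials on an infinite set; `X` and `1−X` are coprime). [folklore] -/
theorem exists_eq_X_pow_mul {a b : ℕ} {Vl Vf : ℤ[X]}
    (hid : ∀ z : ℝ, 1 < z → z ^ a * aeval z Vf = (1 - z) ^ b * aeval z Vl) : ∃ W : ℤ[X], Vl = X ^ a * W := by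
  have hp : (X : ℤ[X]) ^ a * Vf = (1 - X) ^ b * Vl := by
    apply Polynomial.map_injective (Int.castRingHom ℝ) Int.cast_injective
    rw [← sub_eq_zero, ← Polynomial.map_sub]
    apply Polynomial.eq_zero_of_infinite_isRoot
    refine Set.Infinite.mono (fun z hz => ?_) (Set.Ioi_infinite (1 : ℝ))
    have hz : (1 : ℝ) < z := hz
    rw [Set.mem_setOf_eq, IsRoot.def, eval_map, ← algebraMap_int_eq, ← aeval_def, map_sub, map_mul, map_mul,
      map_pow, map_pow, map_sub, map_one, aeval_X, hid z hz, sub_self]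
  have hcop : IsCoprime ((X : ℤ[X]) ^ a) ((1 - X) ^ b) :=
    (show IsCoprime (X : ℤ[X]) (1 - X) from ⟨1, 1, by ring⟩).pow
  have hdvd : (X : ℤ[X]) ^ a ∣ Vl * (1 - X) ^ b := ⟨Vf, by rw [mul_comm, ← hp]⟩
  exact hcop.dvd_of_dvd_mul_right hdvd

/-- Degree after dividing out `X^a`. [folklore] -/
theorem natDegree_le_of_eq_X_pow_mul {a d : ℕ} {V W : ℤ[X]} (hV : V = X ^ a * W) (hd : V.natDegree ≤ d) :
    W.natDegree ≤ d - a := by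
  by_cases hW : W = 0
  · simp [hW]
  · have := natDegree_mul (pow_ne_zero a X_ne_zero) hW
    rw [← hV, natDegree_X_pow] at this
    omega

/-! ### The second representation with Rhin–Viola's Theorem 2.1 -/

/-- Quotient of normalisers `d_H d_{H'}/(d_{H_λ} d_{K_λ})` for the child `(h,j,k+λ,l,m+λ)`. [folklore] -/
theorem lcm_child_dvd_latter {j m q lam : ℕ} (hq : m ≤ j + q) (hlam : lam ≤ j + q - m) (h k l : ℕ) :
    Nat.lcmUpto (RhinViola.bigH h j (k + lam) l (m + lam)) * Nat.lcmUpto (RhinViola.bigK h j (k + lam) l (m + lam)) ∣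
      Nat.lcmUpto (bigH h j k l m q) * Nat.lcmUpto (bigH' h j k l m q) := by
  rw [bigH_eq_rv hq, bigH'_eq_rv hq]
  exact mul_dvd_mul (lcmUpto_dvd_lcmUpto_of_le (RhinViola.bigH_mono (by omega) (by omega) (by omega) (by omega)))
    (lcmUpto_dvd_lcmUpto_of_le (RhinViola.bigK_mono (by omega) (by omega) (by omega) (by omega)))

/-- Quotient of normalisers for the child `(h,j,k+λ,j+l+q−m−λ,m+λ)` of the first representation. [folklore] -/
theorem lcm_child_dvd_former {j m q lam : ℕ} (hq : m ≤ j + q) (hlam : lam ≤ j + q - m) (h k l : ℕ) :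
    Nat.lcmUpto (RhinViola.bigH h j (k + lam) (l + (j + q - m) - lam) (m + lam)) *
        Nat.lcmUpto (RhinViola.bigK h j (k + lam) (l + (j + q - m) - lam) (m + lam)) ∣
      Nat.lcmUpto (bigH h j k l m q) * Nat.lcmUpto (bigH' h j k l m q) := by
  rw [bigH_eq_rv hq, bigH'_eq_rv hq]
  exact mul_dvd_mul (lcmUpto_dvd_lcmUpto_of_le (RhinViola.bigH_mono (by omega) (by omega) (by omega) (by omega)))
    (lcmUpto_dvd_lcmUpto_of_le (RhinViola.bigK_mono (by omega) (by omega) (by omega) (by omega)))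

/-- Exponent bookkeeping of the second representation: `α_λ + q + s = A + k + m + λ`, `β_λ + t = β + λ` with
`s, t ≥ 0`, and `s + t + δ_λ ≤ A + β + h + j − l`. [cite: ViolaZudilin2018, Lemma 2.1 (proof) and (2.4)] -/
theorem bookkeeping_latter {j m q lam : ℕ} (hq : m ≤ j + q) (hlam : lam ≤ j + q - m) (h k l : ℕ) :
    RhinViola.alpha h j (k + lam) l (m + lam) + q ≤ alphaLat h j k l m q + k + m + lam ∧
      RhinViola.beta h j (k + lam) l (m + lam) ≤ beta h j k l m q + lam ∧
      (alphaLat h j k l m q + k + m + lam - q - RhinViola.alpha h j (k + lam) l (m + lam)) +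
          (beta h j k l m q + lam - RhinViola.beta h j (k + lam) l (m + lam)) +
          RhinViola.delta h j (k + lam) l (m + lam) ≤ deltaLat h j k l m q := by
  have hd := RhinViola.delta_eq h j (k + lam) l (m + lam)
  simp only [RhinViola.alpha, RhinViola.beta, alphaLat, alpha, beta, deltaLat] at hd ⊢
  refine ⟨by omega, by omega, ?_⟩
  omega

/-- Exponent bookkeeping of the first representation: `α'_λ + s' = α + j + k + λ`, `β'_λ = B`.
[cite: ViolaZudilin2018, Lemma 2.1 (proof)] -/
theorem bookkeeping_former {j m q lam : ℕ} (hq : m ≤ j + q) (hlam : lam ≤ j + q - m) (h k l : ℕ) :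
    RhinViola.alpha h j (k + lam) (l + (j + q - m) - lam) (m + lam) ≤ alpha h j k l m q + (j + k + lam) ∧
      RhinViola.beta h j (k + lam) (l + (j + q - m) - lam) (m + lam) ≤ betaFor h j k l m q := by
  simp only [RhinViola.alpha, RhinViola.beta, alpha, betaFor]
  exact ⟨by omega, by omega⟩

/-- `(1−z)^n = (−1)^n (z−1)^n`. [folklore] -/
theorem one_sub_pow_eq (z : ℝ) (n : ℕ) : (1 - z) ^ n = (-1) ^ n * (z - 1) ^ n := by
  rw [← neg_sub z 1, neg_pow]

/-- Evaluation of the coefficient polynomials `C c · X^s (X−1)^t`. [folklore] -/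
theorem aeval_C_mul_X_pow_mul_X_sub_one_pow (c : ℤ) (s t : ℕ) (z : ℝ) :
    aeval z (C c * X ^ s * (X - 1) ^ t) = (c : ℝ) * z ^ s * (z - 1) ^ t := by
  have h1 := aeval_C_mul_X_pow_mul c s t 1 z
  rw [mul_one, map_one, mul_one] at h1
  exact h1

/-- **Second representation + RV Theorem 2.1**: the three identities with the normaliser `d_H d_{H'} z^A (1−z)^β`,
`A = max{j+q−m, α}`, and degrees `≤ A + β + h + j − l`. [cite: ViolaZudilin2018, Lemma 2.1 (proof)] -/
theorem latter_identities {h j k l m q : ℕ} (hm : m ≤ j + k) (hq : m ≤ j + q) :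
    ∃ P Q R : ℤ[X], P.natDegree ≤ deltaLat h j k l m q ∧ Q.natDegree ≤ deltaLat h j k l m q ∧
      R.natDegree ≤ deltaLat h j k l m q ∧
      ∀ z : ℝ, 1 < z →
        (Nat.lcmUpto (bigH h j k l m q) : ℝ) * Nat.lcmUpto (bigH' h j k l m q) * z ^ alphaLat h j k l m q *
            (1 - z) ^ beta h j k l m q * J z h j k l m q = aeval z P - aeval z Q * polylogSeries 2 (1 / z) ∧
        (Nat.lcmUpto (bigH h j k l m q) : ℝ) * Nat.lcmUpto (bigH' h j k l m q) * z ^ alphaLat h j k l m q *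
            (1 - z) ^ beta h j k l m q * J₁ z h j k l m q = aeval z R - aeval z Q * polylogSeries 1 (1 / z) ∧
        (Nat.lcmUpto (bigH h j k l m q) : ℝ) * Nat.lcmUpto (bigH' h j k l m q) * z ^ alphaLat h j k l m q *
            (1 - z) ^ beta h j k l m q * J₂ z h j k l m q = aeval z Q := by
  choose P Q R hP hQ hR hid using fun lam => theorem21 h j (k + lam) l (m + lam)
  set N := j + q - m with hN
  -- per-child data
  set r : ℕ → ℕ := fun lam => Nat.lcmUpto (bigH h j k l m q) * Nat.lcmUpto (bigH' h j k l m q) /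
    (Nat.lcmUpto (RhinViola.bigH h j (k + lam) l (m + lam)) * Nat.lcmUpto (RhinViola.bigK h j (k + lam) l (m + lam)))
    with hr
  set s : ℕ → ℕ := fun lam => alphaLat h j k l m q + k + m + lam - q - RhinViola.alpha h j (k + lam) l (m + lam) with hs
  set t : ℕ → ℕ := fun lam => beta h j k l m q + lam - RhinViola.beta h j (k + lam) l (m + lam) with ht
  set E : ℕ → ℤ[X] := fun lam => C ((-1) ^ beta h j k l m q * (N.choose lam : ℤ) * r lam) * X ^ s lam * (X - 1) ^ t lam
    with hE
  -- degrees
  have hdeg : ∀ V : ℕ → ℤ[X], (∀ lam, (V lam).natDegree ≤ RhinViola.delta h j (k + lam) l (m + lam)) →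
      (∑ lam ∈ range (N + 1), E lam * V lam).natDegree ≤ deltaLat h j k l m q := by
    intro V hV
    refine natDegree_sum_le_of_forall_le _ _ fun lam hlam => ?_
    have hle : lam ≤ j + q - m := Nat.lt_succ_iff.1 (mem_range.1 hlam)
    refine (natDegree_C_mul_X_pow_mul_le _ _ _ _).trans ?_
    have hb := (bookkeeping_latter hq hle h k l).2.2
    have hv := hV lam
    simp only [hs, ht]
    omega
  -- the coefficient identity
  have hcoef : ∀ z : ℝ, 1 < z → ∀ lam ∈ range (N + 1),
      (Nat.lcmUpto (bigH h j k l m q) : ℝ) * Nat.lcmUpto (bigH' h j k l m q) * z ^ alphaLat h j k l m q *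
          (1 - z) ^ beta h j k l m q * (((j + q - m).choose lam : ℝ) * z ^ ((k : ℤ) + m - q + lam) * (z - 1) ^ lam) =
        aeval z (E lam) * RhinViola.normaliser h j (k + lam) l (m + lam) z := by
    intro z hz lam hlam
    have hz0 : z ≠ 0 := by positivity
    have hle : lam ≤ j + q - m := Nat.lt_succ_iff.1 (mem_range.1 hlam)
    obtain ⟨hα, hβ, -⟩ := bookkeeping_latter hq hle h k l
    have hdvd := lcm_child_dvd_latter hq hle h k l
    have hr' : (r lam : ℝ) * (Nat.lcmUpto (RhinViola.bigH h j (k + lam) l (m + lam)) *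
        Nat.lcmUpto (RhinViola.bigK h j (k + lam) l (m + lam)) : ℕ) =
        (Nat.lcmUpto (bigH h j k l m q) * Nat.lcmUpto (bigH' h j k l m q) : ℕ) := by
      rw [hr]; exact_mod_cast Nat.div_mul_cancel hdvd
    have hzpow : z ^ alphaLat h j k l m q * z ^ ((k : ℤ) + m - q + lam) =
        z ^ s lam * z ^ RhinViola.alpha h j (k + lam) l (m + lam) := by
      rw [← zpow_natCast, ← zpow_add₀ hz0, ← zpow_natCast, ← zpow_natCast, ← zpow_add₀ hz0]
      congr 1
      have h1 : s lam + RhinViola.alpha h j (k + lam) l (m + lam) + q = alphaLat h j k l m q + k + m + lam := by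
        simp only [hs]; omega
      have h2 := congrArg (fun n : ℕ => (n : ℤ)) h1
      push_cast at h2 ⊢
      linarith
    have hpow1 : (1 - z) ^ beta h j k l m q * (z - 1) ^ lam =
        (-1) ^ beta h j k l m q * ((z - 1) ^ t lam * (z - 1) ^ RhinViola.beta h j (k + lam) l (m + lam)) := by
      rw [one_sub_pow_eq, mul_assoc, ← pow_add, ← pow_add, show t lam + RhinViola.beta h j (k + lam) l (m + lam) =
        beta h j k l m q + lam by simp only [ht]; omega]
    simp only [hE, aeval_C_mul_X_pow_mul_X_sub_one_pow, RhinViola.normaliser]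
    push_cast at hr' ⊢
    calc (Nat.lcmUpto (bigH h j k l m q) : ℝ) * Nat.lcmUpto (bigH' h j k l m q) * z ^ alphaLat h j k l m q *
          (1 - z) ^ beta h j k l m q * (((j + q - m).choose lam : ℝ) * z ^ ((k : ℤ) + m - q + lam) * (z - 1) ^ lam)
        = ((j + q - m).choose lam : ℝ) * (z ^ alphaLat h j k l m q * z ^ ((k : ℤ) + m - q + lam)) *
            ((1 - z) ^ beta h j k l m q * (z - 1) ^ lam) *
            ((Nat.lcmUpto (bigH h j k l m q) : ℝ) * Nat.lcmUpto (bigH' h j k l m q)) := by ring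
      _ = ((j + q - m).choose lam : ℝ) * (z ^ s lam * z ^ RhinViola.alpha h j (k + lam) l (m + lam)) *
            ((-1) ^ beta h j k l m q * ((z - 1) ^ t lam * (z - 1) ^ RhinViola.beta h j (k + lam) l (m + lam))) *
            ((r lam : ℝ) * ((Nat.lcmUpto (RhinViola.bigH h j (k + lam) l (m + lam)) : ℝ) *
              Nat.lcmUpto (RhinViola.bigK h j (k + lam) l (m + lam)))) := by rw [hzpow, hpow1, hr']
      _ = _ := by rw [hN]; ring
  refine ⟨∑ lam ∈ range (N + 1), E lam * P lam, ∑ lam ∈ range (N + 1), E lam * Q lam,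
    ∑ lam ∈ range (N + 1), E lam * R lam, hdeg P hP, hdeg Q hQ, hdeg R hR, fun z hz => ⟨?_, ?_, ?_⟩⟩
  · rw [J_eq_sum_latter hz hm]
    exact sum_combination (range (N + 1)) (hcoef z hz) fun lam _ => (hid lam z hz).1
  · rw [J₁_eq_sum_latter hz hm]
    exact sum_combination (range (N + 1)) (hcoef z hz) fun lam _ => (hid lam z hz).2.1
  · rw [J₂_eq_sum_latter (by positivity) hm]
    exact sum_combination₀ (range (N + 1)) (hcoef z hz) fun lam _ => (hid lam z hz).2.2

/-- **First representation + RV Theorem 2.1**: the three identities with the normaliser `d_H d_{H'} z^α (1−z)^B`,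
`B = max{0, k+l+j+q−m−h}` (degrees not needed). [cite: ViolaZudilin2018, Lemma 2.1 (proof)] -/
theorem former_identities {h j k l m q : ℕ} (hm : m ≤ j + k) (hq : m ≤ j + q) :
    ∃ P Q R : ℤ[X], ∀ z : ℝ, 1 < z →
        (Nat.lcmUpto (bigH h j k l m q) : ℝ) * Nat.lcmUpto (bigH' h j k l m q) * z ^ alpha h j k l m q *
            (1 - z) ^ betaFor h j k l m q * J z h j k l m q = aeval z P - aeval z Q * polylogSeries 2 (1 / z) ∧
        (Nat.lcmUpto (bigH h j k l m q) : ℝ) * Nat.lcmUpto (bigH' h j k l m q) * z ^ alpha h j k l m q *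
            (1 - z) ^ betaFor h j k l m q * J₁ z h j k l m q = aeval z R - aeval z Q * polylogSeries 1 (1 / z) ∧
        (Nat.lcmUpto (bigH h j k l m q) : ℝ) * Nat.lcmUpto (bigH' h j k l m q) * z ^ alpha h j k l m q *
            (1 - z) ^ betaFor h j k l m q * J₂ z h j k l m q = aeval z Q := by
  choose P Q R hP hQ hR hid using fun lam => theorem21 h j (k + lam) (l + (j + q - m) - lam) (m + lam)
  set r : ℕ → ℕ := fun lam => Nat.lcmUpto (bigH h j k l m q) * Nat.lcmUpto (bigH' h j k l m q) /
    (Nat.lcmUpto (RhinViola.bigH h j (k + lam) (l + (j + q - m) - lam) (m + lam)) *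
      Nat.lcmUpto (RhinViola.bigK h j (k + lam) (l + (j + q - m) - lam) (m + lam))) with hr
  set s : ℕ → ℕ := fun lam => alpha h j k l m q + (j + k + lam) - RhinViola.alpha h j (k + lam) (l + (j + q - m) - lam) (m + lam)
    with hs
  set t : ℕ → ℕ := fun lam => betaFor h j k l m q - RhinViola.beta h j (k + lam) (l + (j + q - m) - lam) (m + lam) with ht
  set E : ℕ → ℤ[X] := fun lam => C ((-1) ^ betaFor h j k l m q * ((j + q - m).choose lam : ℤ) * r lam) * X ^ s lam *
    (X - 1) ^ t lam with hE
  have hcoef : ∀ z : ℝ, 1 < z → ∀ lam ∈ range (j + q - m + 1),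
      (Nat.lcmUpto (bigH h j k l m q) : ℝ) * Nat.lcmUpto (bigH' h j k l m q) * z ^ alpha h j k l m q *
          (1 - z) ^ betaFor h j k l m q * (((j + q - m).choose lam : ℝ) * z ^ (j + k + lam)) =
        aeval z (E lam) * RhinViola.normaliser h j (k + lam) (l + (j + q - m) - lam) (m + lam) z := by
    intro z hz lam hlam
    have hle : lam ≤ j + q - m := Nat.lt_succ_iff.1 (mem_range.1 hlam)
    obtain ⟨hα, hβ⟩ := bookkeeping_former hq hle h k l
    have hdvd := lcm_child_dvd_former hq hle h k l
    have hr' : (r lam : ℝ) * (Nat.lcmUpto (RhinViola.bigH h j (k + lam) (l + (j + q - m) - lam) (m + lam)) *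
        Nat.lcmUpto (RhinViola.bigK h j (k + lam) (l + (j + q - m) - lam) (m + lam)) : ℕ) =
        (Nat.lcmUpto (bigH h j k l m q) * Nat.lcmUpto (bigH' h j k l m q) : ℕ) := by
      rw [hr]; exact_mod_cast Nat.div_mul_cancel hdvd
    have hzpow : z ^ alpha h j k l m q * z ^ (j + k + lam) =
        z ^ s lam * z ^ RhinViola.alpha h j (k + lam) (l + (j + q - m) - lam) (m + lam) := by
      rw [← pow_add, ← pow_add]
      congr 1
      simp only [hs]; omega
    have hpow1 : (1 - z) ^ betaFor h j k l m q =
        (-1) ^ betaFor h j k l m q * ((z - 1) ^ t lam * (z - 1) ^ RhinViola.beta h j (k + lam) (l + (j + q - m) - lam) (m + lam)) := by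
      rw [one_sub_pow_eq, ← pow_add, show t lam + RhinViola.beta h j (k + lam) (l + (j + q - m) - lam) (m + lam) =
        betaFor h j k l m q by simp only [ht]; omega]
    simp only [hE, aeval_C_mul_X_pow_mul_X_sub_one_pow, RhinViola.normaliser]
    push_cast at hr' ⊢
    calc (Nat.lcmUpto (bigH h j k l m q) : ℝ) * Nat.lcmUpto (bigH' h j k l m q) * z ^ alpha h j k l m q *
          (1 - z) ^ betaFor h j k l m q * (((j + q - m).choose lam : ℝ) * z ^ (j + k + lam))
        = ((j + q - m).choose lam : ℝ) * (z ^ alpha h j k l m q * z ^ (j + k + lam)) * (1 - z) ^ betaFor h j k l m q *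
            ((Nat.lcmUpto (bigH h j k l m q) : ℝ) * Nat.lcmUpto (bigH' h j k l m q)) := by ring
      _ = ((j + q - m).choose lam : ℝ) * (z ^ s lam * z ^ RhinViola.alpha h j (k + lam) (l + (j + q - m) - lam) (m + lam)) *
            ((-1) ^ betaFor h j k l m q *
              ((z - 1) ^ t lam * (z - 1) ^ RhinViola.beta h j (k + lam) (l + (j + q - m) - lam) (m + lam))) *
            ((r lam : ℝ) * ((Nat.lcmUpto (RhinViola.bigH h j (k + lam) (l + (j + q - m) - lam) (m + lam)) : ℝ) *
              Nat.lcmUpto (RhinViola.bigK h j (k + lam) (l + (j + q - m) - lam) (m + lam)))) := by rw [hzpow, hpow1, hr']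
      _ = _ := by ring
  refine ⟨∑ lam ∈ range (j + q - m + 1), E lam * P lam, ∑ lam ∈ range (j + q - m + 1), E lam * Q lam,
    ∑ lam ∈ range (j + q - m + 1), E lam * R lam, fun z hz => ⟨?_, ?_, ?_⟩⟩
  · rw [J_eq_sum_former hz hm hq]
    exact sum_combination (range (j + q - m + 1)) (hcoef z hz) fun lam _ => (hid lam z hz).1
  · rw [J₁_eq_sum_former hz hm hq]
    exact sum_combination (range (j + q - m + 1)) (hcoef z hz) fun lam _ => (hid lam z hz).2.1
  · rw [J₂_eq_sum_former (by positivity) hm hq]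
    exact sum_combination₀ (range (j + q - m + 1)) (hcoef z hz) fun lam _ => (hid lam z hz).2.2

/-! ### Lemma 2.1 -/

/-- **Viola–Zudilin 2018, Lemma 2.1.** For `h, j, k, l, m, q ≥ 0` with `j+k ≥ m`, `j+q ≥ m`, and
`H, H', α, β, δ` of (2.1) (`ViolaZudilin.bigH/bigH'/alpha/beta/delta`), there are `P, Q, R ∈ ℤ[X]` of degrees
`≤ δ` such that for every real `z > 1`:
`d_H d_{H'} z^α (1−z)^β J_z(h,j,k,l,m,q) = P(z) − Q(z) Li₂(1/z)`,
`d_H d_{H'} z^α (1−z)^β J_z^{(1)}(h,j,k,l,m,q) = R(z) − Q(z) Li₁(1/z)`, and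
`d_H d_{H'} z^α (1−z)^β J_z^{(2)}(h,j,k,l,m,q) = Q(z)` ((2.2)–(2.3)). [cite: ViolaZudilin2018, Lemma 2.1] -/
theorem lemma21 {h j k l m q : ℕ} (hm : m ≤ j + k) (hq : m ≤ j + q) :
    ∃ P Q R : ℤ[X], P.natDegree ≤ delta h j k l m q ∧ Q.natDegree ≤ delta h j k l m q ∧
      R.natDegree ≤ delta h j k l m q ∧
      ∀ z : ℝ, 1 < z →
        (Nat.lcmUpto (bigH h j k l m q) : ℝ) * Nat.lcmUpto (bigH' h j k l m q) * z ^ alpha h j k l m q *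
            (1 - z) ^ beta h j k l m q * J z h j k l m q = aeval z P - aeval z Q * polylogSeries 2 (1 / z) ∧
        (Nat.lcmUpto (bigH h j k l m q) : ℝ) * Nat.lcmUpto (bigH' h j k l m q) * z ^ alpha h j k l m q *
            (1 - z) ^ beta h j k l m q * J₁ z h j k l m q = aeval z R - aeval z Q * polylogSeries 1 (1 / z) ∧
        (Nat.lcmUpto (bigH h j k l m q) : ℝ) * Nat.lcmUpto (bigH' h j k l m q) * z ^ alpha h j k l m q *
            (1 - z) ^ beta h j k l m q * J₂ z h j k l m q = aeval z Q := by
  obtain ⟨Pl, Ql, Rl, hPl, hQl, hRl, hidl⟩ := latter_identities hm hq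
  obtain ⟨Pf, Qf, Rf, hidf⟩ := former_identities hm hq
  set Nd : ℝ := (Nat.lcmUpto (bigH h j k l m q) : ℝ) * Nat.lcmUpto (bigH' h j k l m q) with hNd
  set a := alphaLat h j k l m q - alpha h j k l m q with ha
  set b := betaFor h j k l m q - beta h j k l m q with hb
  have haA : a + alpha h j k l m q = alphaLat h j k l m q := by simp only [ha, alphaLat]; omega
  have hbB : b + beta h j k l m q = betaFor h j k l m q := by simp only [hb, betaFor, beta]; omega
  -- both normalisers reach `Nd z^A (1−z)^B`
  have hboth : ∀ z : ℝ, ∀ F : ℝ, z ^ a * (Nd * z ^ alpha h j k l m q * (1 - z) ^ betaFor h j k l m q * F) =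
      (1 - z) ^ b * (Nd * z ^ alphaLat h j k l m q * (1 - z) ^ beta h j k l m q * F) := by
    intro z F
    rw [← haA, ← hbB, pow_add, pow_add]
    ring
  have key2 : ∀ z : ℝ, 1 < z → z ^ a * aeval z Qf = (1 - z) ^ b * aeval z Ql := by
    intro z hz
    rw [← (hidf z hz).2.2, ← (hidl z hz).2.2, hboth]
  have key1 : ∀ z : ℝ, 1 < z → z ^ a * aeval z Rf = (1 - z) ^ b * aeval z Rl := by
    intro z hz
    have e := hboth z (J₁ z h j k l m q)
    rw [(hidf z hz).2.1, (hidl z hz).2.1] at e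
    linear_combination e + polylogSeries 1 (1 / z) * key2 z hz
  have key0 : ∀ z : ℝ, 1 < z → z ^ a * aeval z Pf = (1 - z) ^ b * aeval z Pl := by
    intro z hz
    have e := hboth z (J z h j k l m q)
    rw [(hidf z hz).1, (hidl z hz).1] at e
    linear_combination e + polylogSeries 2 (1 / z) * key2 z hz
  obtain ⟨Qt, hQt⟩ := exists_eq_X_pow_mul key2
  obtain ⟨Rt, hRt⟩ := exists_eq_X_pow_mul key1
  obtain ⟨Pt, hPt⟩ := exists_eq_X_pow_mul key0
  have hδ : deltaLat h j k l m q - a = delta h j k l m q := by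
    simp only [deltaLat, delta, ha, alphaLat, beta]; omega
  refine ⟨Pt, Qt, Rt, hδ ▸ natDegree_le_of_eq_X_pow_mul hPt hPl, hδ ▸ natDegree_le_of_eq_X_pow_mul hQt hQl,
    hδ ▸ natDegree_le_of_eq_X_pow_mul hRt hRl, fun z hz => ?_⟩
  have hz0 : z ^ a ≠ 0 := pow_ne_zero _ (by positivity)
  have hlift : ∀ F : ℝ, Nd * z ^ alphaLat h j k l m q * (1 - z) ^ beta h j k l m q * F =
      z ^ a * (Nd * z ^ alpha h j k l m q * (1 - z) ^ beta h j k l m q * F) := by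
    intro F; rw [← haA, pow_add]; ring
  obtain ⟨e0, e1, e2⟩ := hidl z hz
  rw [hlift, hPt, hQt, map_mul, map_mul, map_pow, aeval_X] at e0
  rw [hlift, hRt, hQt, map_mul, map_mul, map_pow, aeval_X] at e1
  rw [hlift, hQt, map_mul, map_pow, aeval_X] at e2
  refine ⟨mul_left_cancel₀ hz0 ?_, mul_left_cancel₀ hz0 ?_, mul_left_cancel₀ hz0 ?_⟩
  · rw [e0]; ring
  · rw [e1]; ring
  · rw [e2]

end ViolaZudilin

end Literature.NumberTheory.DiophantineApproximation

end
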